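import Summits.CriticalPhenomena.CardyFormulaZ2.Theorems.CardySusyWardParafermionFamiliesToSLESixAnchorDefs
import Summits.CriticalPhenomena.CardyFormulaZ2.Theorems.CardySusyWardParafermionFamiliesToSLESixAnchorGeometry

/-!
# The concrete anchor family (skeleton r4 of line `strip-anchored-vertex-normalisation`,
# crux stmt-CriticalPhenomena-10814), II: the discrete arcs of `anchorData δ`

Helper file 1/2 of the registered sub-goal `stub_anchorData_lattice` of the stub `stub_anchorMoment_of_IP`.
For the concrete Dobrushin data `anchorData δ` of `…AnchorDefs.lean` (carrier the diagonal square
`anchorDomain = {|x+y| < 2, |x-y| < 2}`, mesh `δ`, free arc `arcB = {x + y = 2, |x - y| ≤ (L - 5/2) δ}`,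
wired arc `arcA = ∂Ω ∖ arcB`, `L = ⌈2/δ⌉ - 1`, i.e. `L δ < 2 ≤ (L + 1) δ`) and `L ≥ 4`, in the coordinates
`s = v₀ + v₁`, `d = v₀ - v₁` of a site `v`:

* `mem_zdArcB_iff`: the discrete free arc `zdArcB` is EXACTLY the set of free-layer boundary sites
  `L - 1 ≤ s ≤ L` with `|d| ≤ L - 3`;
* `mem_zdArcA_iff`: the discrete wired arc `zdArcA` is the rest of the discrete boundary (no ties: the
  threshold `L - 5/2` is a half-integer in the lattice column `d`).

Method (frontier-distance rule `zdDiscreteArc`): with `2·dist² = Δs² + Δd²` in level/column coordinates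
(`two_mul_dist_sq`), a free-layer site with `|d| ≤ L - 3` has its foot on the free line inside `arcB`
(`2·dist² = (2 - δ s)²`) while every point of `arcA` is farther by the uniform gap `δ²/4` (`gap_free`); in
the three other cases (free layer with `|d| ≥ L - 2`, bottom layer, lateral layers) the foot on the own side
lies in `arcA` and `arcB` is farther by the same gap (`gap_ends`, `gap_bottom`, `gap_lateral`); a witness
plus a uniform gap compare the two `infDist` strictly (`infDist_lt_infDist`). Registered one-line form:
`stub_anchorData_arcs`. All elementary. [folklore]
-/

noncomputable section

namespace Summit.CriticalPhenomena.CardyFormulaZ2.Theorems.ParafermionFamiliesToSLESix.StripAnchored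

open MeasureTheory Filter Set Metric
open scoped Topology BigOperators
open Literature.Probability.LatticeModels
open Literature.Probability.Percolation (bondPercolation half BondConfig)
open Literature.Probability.RandomPlanarGeometry (DobrushinDomain)
open Summit.CriticalPhenomena.CardyFormulaZ2.Theorems.ParafermionPrecompact.Negative (IsFamily VanishesOn)
open S5 (anchorDomain)

namespace AnchorLattice

open Literature.Probability.RandomPlanarGeometry

variable {δ : ℝ} {L : ℤ}

/-! ## The level `L = ⌈2/δ⌉ - 1` and the arcs of `anchorData δ` -/

/-- The level is determined by `L δ < 2 ≤ (L + 1) δ`: `⌈2/δ⌉ - 1 = L`. [folklore] -/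
theorem ceil_sub_one_eq (hδ : 0 < δ) (hLδ : (L : ℝ) * δ < 2) (hL1 : 2 ≤ ((L : ℝ) + 1) * δ) :
    ⌈2 / δ⌉ - 1 = L := by
  have h1 : (L : ℝ) < 2 / δ := by rw [lt_div_iff₀ hδ]; exact hLδ
  have h2 : 2 / δ ≤ (L : ℝ) + 1 := by rw [div_le_iff₀ hδ]; exact hL1
  have h1' : L < ⌈2 / δ⌉ := Int.lt_ceil.2 h1
  have h2' : ⌈2 / δ⌉ ≤ L + 1 := Int.ceil_le.2 (by exact_mod_cast h2)
  omega

/-- The free arc of `anchorData δ`: level `2`, column `|x - y| ≤ (L - 5/2) δ`. [folklore] -/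
theorem mem_arcB_iff (hδ : 0 < δ) (hLδ : (L : ℝ) * δ < 2) (hL1 : 2 ≤ ((L : ℝ) + 1) * δ) {z : ℂ} :
    z ∈ (anchorData δ).arcB ↔ z.re + z.im = 2 ∧ |z.re - z.im| ≤ ((L : ℝ) - 5 / 2) * δ := by
  show z ∈ anchorArcB δ ↔ _
  rw [anchorArcB, Set.mem_setOf_eq, ceil_sub_one_eq hδ hLδ hL1]

/-- The free arc lies on the frontier of the square. [folklore] -/
theorem arcB_subset_frontier (hδ : 0 < δ) (hLδ : (L : ℝ) * δ < 2) (hL1 : 2 ≤ ((L : ℝ) + 1) * δ) :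
    (anchorData δ).arcB ⊆ frontier anchorDomain.carrier := by
  intro z hz
  rw [mem_arcB_iff hδ hLδ hL1] at hz
  refine S5.mem_frontier_anchor (Or.inr ⟨by rw [hz.1]; norm_num, hz.2.trans ?_⟩)
  nlinarith

/-- The wired arc of `anchorData δ` is the rest of the frontier. [folklore] -/
theorem mem_arcA_iff {z : ℂ} :
    z ∈ (anchorData δ).arcA ↔ z ∈ frontier anchorDomain.carrier ∧ z ∉ (anchorData δ).arcB := Iff.rfl

/-- The complement of the wired arc in the frontier is the free arc. [folklore] -/
theorem frontier_diff_arcA (hδ : 0 < δ) (hLδ : (L : ℝ) * δ < 2) (hL1 : 2 ≤ ((L : ℝ) + 1) * δ) :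
    frontier (anchorData δ).Ω \ (anchorData δ).arcA = (anchorData δ).arcB :=
  Set.sdiff_sdiff_cancel_left (arcB_subset_frontier hδ hLδ hL1)

/-- Frontier points of the square lie on one of its four sides (level/column form). [folklore] -/
theorem level_column_of_mem_frontier {z : ℂ} (hz : z ∈ frontier anchorDomain.carrier) :
    (|z.re + z.im| ≤ 2 ∧ |z.re - z.im| = 2) ∨ (|z.re + z.im| = 2 ∧ |z.re - z.im| ≤ 2) := by
  rw [S5.frontier_anchorDomain_carrier_eq] at hz
  obtain ⟨u, hu, rfl⟩ := hz
  rw [mem_frontier_symRect one_pos one_pos] at hu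
  rw [S5.rotHomeo_apply, S5.rotC_mul_re, S5.rotC_mul_im,
    show u.im - u.re + -(u.re + u.im) = -2 * u.re by ring,
    show u.im - u.re - -(u.re + u.im) = 2 * u.im by ring]
  rcases hu with ⟨⟨h1, h2⟩, h3 | h3⟩ | ⟨h3 | h3, h1, h2⟩
  · left; exact ⟨abs_le.2 ⟨by linarith, by linarith⟩, by rw [h3]; norm_num⟩
  · left; exact ⟨abs_le.2 ⟨by linarith, by linarith⟩, by rw [h3]; norm_num⟩
  · right; exact ⟨by rw [h3]; norm_num, abs_le.2 ⟨by linarith, by linarith⟩⟩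
  · right; exact ⟨by rw [h3]; norm_num, abs_le.2 ⟨by linarith, by linarith⟩⟩

/-- The wired arc is nonempty (the bottom corner `-1 - i`). [folklore] -/
theorem arcA_nonempty (hδ : 0 < δ) (hLδ : (L : ℝ) * δ < 2) (hL1 : 2 ≤ ((L : ℝ) + 1) * δ) :
    ((anchorData δ).arcA).Nonempty := by
  refine ⟨⟨-1, -1⟩, mem_arcA_iff.2 ⟨S5.mem_frontier_anchor (Or.inr ⟨by norm_num, by norm_num⟩), ?_⟩⟩
  rw [mem_arcB_iff hδ hLδ hL1]
  norm_num

/-- The free arc is nonempty (the wall point `1 + i`) once `L ≥ 4`. [folklore] -/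
theorem arcB_nonempty (hδ : 0 < δ) (hLδ : (L : ℝ) * δ < 2) (hL1 : 2 ≤ ((L : ℝ) + 1) * δ) (hL : 4 ≤ L) :
    ((anchorData δ).arcB).Nonempty := by
  refine ⟨⟨1, 1⟩, (mem_arcB_iff hδ hLδ hL1).2 ⟨by norm_num, ?_⟩⟩
  have : (4 : ℝ) ≤ L := by exact_mod_cast hL
  norm_num; nlinarith

/-! ## Distances in level/column coordinates -/

/-- `2·dist(p, z)² = (Δ level)² + (Δ column)²`. [folklore] -/
theorem two_mul_dist_sq (p z : ℂ) : 2 * dist p z ^ 2 =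
    ((p.re + p.im) - (z.re + z.im)) ^ 2 + ((p.re - p.im) - (z.re - z.im)) ^ 2 := by
  rw [Complex.dist_eq, Complex.sq_norm, Complex.normSq_apply, Complex.sub_re, Complex.sub_im]; ring

/-- **Strict comparison of distances to two sets** from a witness in the first and a uniform gap for
the second: `infDist p S ≤ dist p w < √(dist² + g/2) ≤ infDist p T`. [folklore] -/
theorem infDist_lt_infDist {p w : ℂ} {S T : Set ℂ} (hw : w ∈ S) (hT : T.Nonempty) {g : ℝ} (hg : 0 < g)
    (h : ∀ z ∈ T, 2 * dist p w ^ 2 + g ≤ 2 * dist p z ^ 2) : infDist p S < infDist p T := by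
  have hK : dist p w < Real.sqrt (dist p w ^ 2 + g / 2) := (Real.lt_sqrt dist_nonneg).2 (by linarith)
  refine (infDist_le_dist_of_mem hw).trans_lt (hK.trans_le ((le_infDist hT).2 fun z hz => ?_))
  calc Real.sqrt (dist p w ^ 2 + g / 2) ≤ Real.sqrt (dist p z ^ 2) :=
        Real.sqrt_le_sqrt (by linarith [h z hz])
    _ = dist p z := Real.sqrt_sq dist_nonneg

/-- Gap inequality of the FREE case: `Λ = δL`, `X = δs ∈ [Λ - δ, Λ]`, `|Y| = δ|d| ≤ Λ - 3δ`; a point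
`(σ, τ)` of `arcA` (on a side, off `arcB`) satisfies `(2 - X)² + δ²/4 ≤ (X - σ)² + (Y - τ)²`. [folklore] -/
theorem gap_free {δ Λ X Y σ τ : ℝ} (hδ : 0 < δ) (hΛ : Λ < 2) (hΛ4 : 4 * δ ≤ Λ)
    (hX1 : Λ - δ ≤ X) (hX2 : X ≤ Λ) (hY : |Y| ≤ Λ - 3 * δ)
    (hz : (|σ| ≤ 2 ∧ |τ| = 2) ∨ (|σ| = 2 ∧ |τ| ≤ 2)) (hzB : σ = 2 → (Λ - 5 / 2 * δ) < |τ|) :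
    (2 - X) ^ 2 + δ ^ 2 / 4 ≤ (X - σ) ^ 2 + (Y - τ) ^ 2 := by
  have hσ0 : 0 ≤ (X - σ) ^ 2 := sq_nonneg _
  rw [abs_le] at hY
  rcases hz with ⟨-, h2⟩ | ⟨h1, -⟩
  · -- a lateral side `|τ| = 2`
    rcases (abs_eq (by norm_num : (0:ℝ) ≤ 2)).1 h2 with rfl | rfl
    · nlinarith [mul_nonneg (show (0:ℝ) ≤ 2 - Y - (2 - X) - 2 * δ by linarith)
        (show (0:ℝ) ≤ 2 - Y + (2 - X) by linarith)]
    · nlinarith [mul_nonneg (show (0:ℝ) ≤ 2 + Y - (2 - X) - 2 * δ by linarith)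
        (show (0:ℝ) ≤ 2 + Y + (2 - X) by linarith)]
  · rcases (abs_eq (by norm_num : (0:ℝ) ≤ 2)).1 h1 with rfl | rfl
    · -- the free side off `arcB`: `|τ| > Λ - 5δ/2`, so `|Y - τ| > δ/2`
      have hτ := hzB rfl
      have hYτ : δ / 2 < |Y - τ| := by
        have := abs_sub_abs_le_abs_sub τ Y
        rw [abs_sub_comm] at this
        have hY' : |Y| ≤ Λ - 3 * δ := abs_le.2 hY
        linarith
      have hsq : (δ / 2) ^ 2 < |Y - τ| ^ 2 := by gcongr
      rw [sq_abs] at hsq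
      nlinarith
    · -- the bottom side `σ = -2`
      nlinarith [sq_nonneg (Y - τ)]

/-- Gap inequality of the WIRED free-layer case: `X ∈ [Λ - δ, Λ]`, `Λ - 2δ ≤ |Y|`; a point `(2, τ)` of
`arcB` (`|τ| ≤ Λ - 5δ/2`) satisfies `(2 - X)² + δ²/4 ≤ (X - 2)² + (Y - τ)²`. [folklore] -/
theorem gap_ends {δ Λ X Y τ : ℝ} (hδ : 0 < δ) (hY : Λ - 2 * δ ≤ |Y|) (hτ : |τ| ≤ Λ - 5 / 2 * δ) :
    (2 - X) ^ 2 + δ ^ 2 / 4 ≤ (X - 2) ^ 2 + (Y - τ) ^ 2 := by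
  have hYτ : δ / 2 ≤ |Y - τ| := by linarith [abs_sub_abs_le_abs_sub Y τ]
  have hsq : (δ / 2) ^ 2 ≤ |Y - τ| ^ 2 := pow_le_pow_left₀ (by linarith) hYτ 2
  rw [sq_abs] at hsq
  nlinarith

/-- Gap inequality of the BOTTOM case: `X ∈ [-Λ, -(Λ - δ)]`, witness `2·dist² = (X + 2)²`; a point
`(2, τ)` of `arcB` satisfies `(X + 2)² + δ²/4 ≤ (X - 2)² + (Y - τ)²`. [folklore] -/
theorem gap_bottom {δ Λ X Y τ : ℝ} (hδ : 0 < δ) (hΛ : Λ < 2) (hΛ4 : 4 * δ ≤ Λ) (hX2 : X ≤ -(Λ - δ)) :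
    (X + 2) ^ 2 + δ ^ 2 / 4 ≤ (X - 2) ^ 2 + (Y - τ) ^ 2 := by
  nlinarith [sq_nonneg (Y - τ)]

/-- Gap inequality of the LATERAL case: `X ≤ Λ - 2δ`, `Λ - δ ≤ |Y| ≤ Λ`, witness `2·dist² = (2 - |Y|)²`;
a point `(2, τ)` of `arcB` satisfies `(2 - |Y|)² + δ²/4 ≤ (X - 2)² + (Y - τ)²`. [folklore] -/
theorem gap_lateral {δ Λ X Y τ : ℝ} (hδ : 0 < δ) (hΛ : Λ < 2) (hX2 : X ≤ Λ - 2 * δ)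
    (hY1 : Λ - δ ≤ |Y|) (hY2 : |Y| ≤ Λ) :
    (2 - |Y|) ^ 2 + δ ^ 2 / 4 ≤ (X - 2) ^ 2 + (Y - τ) ^ 2 := by
  nlinarith [sq_nonneg (Y - τ), mul_nonneg (show (0:ℝ) ≤ (2 - X) - (2 - |Y|) - δ by linarith)
    (show (0:ℝ) ≤ (2 - X) + (2 - |Y|) by linarith)]

/-! ## The four comparisons at boundary sites -/

/-- Real form of the lattice hypotheses at a site. [folklore] -/
theorem site_real (hδ : 0 < δ) (hLδ : (L : ℝ) * δ < 2) (hL1 : 2 ≤ ((L : ℝ) + 1) * δ) (hL : 4 ≤ L)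
    (v : Site 2) :
    δ * L < 2 ∧ 2 ≤ δ * L + δ ∧ 4 * δ ≤ δ * L ∧
      (meshPoint δ v).re + (meshPoint δ v).im = δ * ((v 0 : ℝ) + v 1) ∧
      (meshPoint δ v).re - (meshPoint δ v).im = δ * ((v 0 : ℝ) - v 1) ∧
      (∀ a b : ℤ, a ≤ b → δ * (a : ℝ) ≤ δ * (b : ℝ)) ∧
      |δ * ((v 0 : ℝ) - v 1)| = δ * |(v 0 : ℝ) - v 1| := by
  obtain ⟨h1, h2⟩ := S5.anchor_meshPoint_level_column δ v
  have hL' : (4 : ℝ) ≤ L := by exact_mod_cast hL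
  exact ⟨by linarith, by linarith, by nlinarith, h1, h2,
    fun a b hab => mul_le_mul_of_nonneg_left (by exact_mod_cast hab) hδ.le, by rw [abs_mul, abs_of_pos hδ]⟩

/-- **Free case**: a free-layer site `L - 1 ≤ s ≤ L` with `|d| ≤ L - 3` is strictly closer to `arcB`.
[folklore] -/
theorem infDist_lt_of_free (hδ : 0 < δ) (hLδ : (L : ℝ) * δ < 2) (hL1 : 2 ≤ ((L : ℝ) + 1) * δ)
    (hL : 4 ≤ L) {v : Site 2} (hs : L - 1 ≤ v 0 + v 1) (hsL : v 0 + v 1 ≤ L)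
    (hd : |v 0 - v 1| ≤ L - 3) :
    infDist (meshPoint δ v) (anchorData δ).arcB < infDist (meshPoint δ v) (anchorData δ).arcA := by
  obtain ⟨hΛ, hΛ1, hΛ4, hpre, hpim, hmono, habs⟩ := site_real hδ hLδ hL1 hL v
  set p := meshPoint δ v
  have hX1 := hmono _ _ hs
  have hX2 := hmono _ _ hsL
  have hY := hmono _ _ hd
  push_cast at hX1 hX2 hY
  rw [← habs] at hY
  -- the foot on the free line
  set w : ℂ := ⟨(2 + δ * ((v 0 : ℝ) - v 1)) / 2, (2 - δ * ((v 0 : ℝ) - v 1)) / 2⟩ with hw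
  have hw1 : w.re + w.im = 2 := by simp only [hw]; ring
  have hw2 : w.re - w.im = δ * ((v 0 : ℝ) - v 1) := by simp only [hw]; ring
  have hwB : w ∈ (anchorData δ).arcB := by
    rw [mem_arcB_iff hδ hLδ hL1]
    exact ⟨hw1, by rw [hw2]; linarith⟩
  have hdw : 2 * dist p w ^ 2 = (2 - δ * ((v 0 : ℝ) + v 1)) ^ 2 := by
    rw [two_mul_dist_sq, hpre, hpim, hw1, hw2]; ring
  refine infDist_lt_infDist hwB (arcA_nonempty hδ hLδ hL1) (g := δ ^ 2 / 4) (by positivity)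
    fun z hz => ?_
  rw [hdw, two_mul_dist_sq, hpre, hpim]
  obtain ⟨hzf, hzB⟩ := mem_arcA_iff.1 hz
  rw [mem_arcB_iff hδ hLδ hL1, not_and, not_le] at hzB
  refine gap_free hδ hΛ hΛ4 (by linarith) hX2 (by linarith) (level_column_of_mem_frontier hzf)
    fun h => ?_
  linarith [hzB h]

/-- **Free-layer wired case**: a free-layer site with `|d| ≥ L - 2` is strictly closer to `arcA` (its
foot on the free line lies off `arcB`). [folklore] -/
theorem infDist_lt_of_ends (hδ : 0 < δ) (hLδ : (L : ℝ) * δ < 2) (hL1 : 2 ≤ ((L : ℝ) + 1) * δ)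
    (hL : 4 ≤ L) {v : Site 2} (hs : L - 1 ≤ v 0 + v 1) (hsL : v 0 + v 1 ≤ L)
    (hd : L - 2 ≤ |v 0 - v 1|) (hdL : |v 0 - v 1| ≤ L) :
    infDist (meshPoint δ v) (anchorData δ).arcA < infDist (meshPoint δ v) (anchorData δ).arcB := by
  obtain ⟨hΛ, hΛ1, hΛ4, hpre, hpim, hmono, habs⟩ := site_real hδ hLδ hL1 hL v
  set p := meshPoint δ v
  have hX1 := hmono _ _ hs
  have hX2 := hmono _ _ hsL
  have hY := hmono _ _ hd
  have hYL := hmono _ _ hdL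
  push_cast at hX1 hX2 hY hYL
  rw [← habs] at hY hYL
  set w : ℂ := ⟨(2 + δ * ((v 0 : ℝ) - v 1)) / 2, (2 - δ * ((v 0 : ℝ) - v 1)) / 2⟩ with hw
  have hw1 : w.re + w.im = 2 := by simp only [hw]; ring
  have hw2 : w.re - w.im = δ * ((v 0 : ℝ) - v 1) := by simp only [hw]; ring
  have hwA : w ∈ (anchorData δ).arcA := by
    refine mem_arcA_iff.2 ⟨S5.mem_frontier_anchor (Or.inr ⟨by rw [hw1]; norm_num, ?_⟩), fun h => ?_⟩
    · rw [hw2]; linarith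
    · rw [mem_arcB_iff hδ hLδ hL1, hw2] at h
      linarith [h.2]
  have hdw : 2 * dist p w ^ 2 = (2 - δ * ((v 0 : ℝ) + v 1)) ^ 2 := by
    rw [two_mul_dist_sq, hpre, hpim, hw1, hw2]; ring
  refine infDist_lt_infDist hwA (arcB_nonempty hδ hLδ hL1 hL) (g := δ ^ 2 / 4) (by positivity)
    fun z hz => ?_
  rw [hdw, two_mul_dist_sq, hpre, hpim]
  obtain ⟨hz1, hz2⟩ := (mem_arcB_iff hδ hLδ hL1).1 hz
  rw [hz1]
  exact gap_ends (Λ := δ * L) hδ (by linarith) (by linarith)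

/-- **Bottom case**: a site of level `s ≤ -(L - 1)` is strictly closer to `arcA` (its foot on the
bottom side). [folklore] -/
theorem infDist_lt_of_bottom (hδ : 0 < δ) (hLδ : (L : ℝ) * δ < 2) (hL1 : 2 ≤ ((L : ℝ) + 1) * δ)
    (hL : 4 ≤ L) {v : Site 2} (hs : -L ≤ v 0 + v 1) (hsL : v 0 + v 1 ≤ -(L - 1))
    (hdL : |v 0 - v 1| ≤ L) :
    infDist (meshPoint δ v) (anchorData δ).arcA < infDist (meshPoint δ v) (anchorData δ).arcB := by
  obtain ⟨hΛ, hΛ1, hΛ4, hpre, hpim, hmono, habs⟩ := site_real hδ hLδ hL1 hL v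
  set p := meshPoint δ v
  have hX1 := hmono _ _ hs
  have hX2 := hmono _ _ hsL
  have hYL := hmono _ _ hdL
  push_cast at hX1 hX2 hYL
  rw [← habs] at hYL
  set w : ℂ := ⟨(-2 + δ * ((v 0 : ℝ) - v 1)) / 2, (-2 - δ * ((v 0 : ℝ) - v 1)) / 2⟩ with hw
  have hw1 : w.re + w.im = -2 := by simp only [hw]; ring
  have hw2 : w.re - w.im = δ * ((v 0 : ℝ) - v 1) := by simp only [hw]; ring
  have hwA : w ∈ (anchorData δ).arcA := by
    refine mem_arcA_iff.2 ⟨S5.mem_frontier_anchor (Or.inr ⟨by rw [hw1]; norm_num, ?_⟩), fun h => ?_⟩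
    · rw [hw2]; linarith
    · rw [mem_arcB_iff hδ hLδ hL1, hw1] at h
      linarith [h.1]
  have hdw : 2 * dist p w ^ 2 = (δ * ((v 0 : ℝ) + v 1) + 2) ^ 2 := by
    rw [two_mul_dist_sq, hpre, hpim, hw1, hw2]; ring
  refine infDist_lt_infDist hwA (arcB_nonempty hδ hLδ hL1 hL) (g := δ ^ 2 / 4) (by positivity)
    fun z hz => ?_
  rw [hdw, two_mul_dist_sq, hpre, hpim]
  obtain ⟨hz1, -⟩ := (mem_arcB_iff hδ hLδ hL1).1 hz
  rw [hz1]
  exact gap_bottom hδ hΛ hΛ4 (by linarith)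

/-- **Lateral case**: a site of level `s ≤ L - 2` and column `|d| ≥ L - 1` is strictly closer to `arcA`
(its foot on its lateral side). [folklore] -/
theorem infDist_lt_of_lateral (hδ : 0 < δ) (hLδ : (L : ℝ) * δ < 2) (hL1 : 2 ≤ ((L : ℝ) + 1) * δ)
    (hL : 4 ≤ L) {v : Site 2} (hs : -L ≤ v 0 + v 1) (hsL : v 0 + v 1 ≤ L - 2)
    (hd : L - 1 ≤ |v 0 - v 1|) (hdL : |v 0 - v 1| ≤ L) :
    infDist (meshPoint δ v) (anchorData δ).arcA < infDist (meshPoint δ v) (anchorData δ).arcB := by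
  obtain ⟨hΛ, hΛ1, hΛ4, hpre, hpim, hmono, habs⟩ := site_real hδ hLδ hL1 hL v
  set p := meshPoint δ v
  have hX1 := hmono _ _ hs
  have hX2 := hmono _ _ hsL
  have hY := hmono _ _ hd
  have hYL := hmono _ _ hdL
  push_cast at hX1 hX2 hY hYL
  rw [← habs] at hY hYL
  -- the sign `ε = ±2` of the column picks the lateral side
  obtain ⟨ε, hε, hεY⟩ : ∃ ε : ℝ, |ε| = 2 ∧ (δ * ((v 0 : ℝ) - v 1) - ε) ^ 2 = (2 - |δ * ((v 0 : ℝ) - v 1)|) ^ 2 := by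
    rcases le_or_gt 0 (δ * ((v 0 : ℝ) - v 1)) with h | h
    · exact ⟨2, by norm_num, by rw [abs_of_nonneg h]; ring⟩
    · exact ⟨-2, by norm_num, by rw [abs_of_neg h]; ring⟩
  set w : ℂ := ⟨(δ * ((v 0 : ℝ) + v 1) + ε) / 2, (δ * ((v 0 : ℝ) + v 1) - ε) / 2⟩ with hw
  have hw1 : w.re + w.im = δ * ((v 0 : ℝ) + v 1) := by simp only [hw]; ring
  have hw2 : w.re - w.im = ε := by simp only [hw]; ring
  have hwA : w ∈ (anchorData δ).arcA := by
    refine mem_arcA_iff.2 ⟨S5.mem_frontier_anchor (Or.inl ⟨?_, by rw [hw2, hε]⟩), fun h => ?_⟩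
    · rw [hw1, abs_le]; constructor <;> linarith
    · rw [mem_arcB_iff hδ hLδ hL1, hw1] at h
      linarith [h.1]
  have hdw : 2 * dist p w ^ 2 = (2 - |δ * ((v 0 : ℝ) - v 1)|) ^ 2 := by
    rw [two_mul_dist_sq, hpre, hpim, hw1, hw2, ← hεY]; ring
  refine infDist_lt_infDist hwA (arcB_nonempty hδ hLδ hL1 hL) (g := δ ^ 2 / 4) (by positivity)
    fun z hz => ?_
  rw [hdw, two_mul_dist_sq, hpre, hpim]
  obtain ⟨hz1, -⟩ := (mem_arcB_iff hδ hLδ hL1).1 hz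
  rw [hz1]
  exact gap_lateral hδ hΛ (by linarith) (by linarith) (by linarith)

/-- **Wired case, assembled**: a boundary site outside the free window is strictly closer to `arcA`.
[folklore] -/
theorem infDist_lt_of_wired (hδ : 0 < δ) (hLδ : (L : ℝ) * δ < 2) (hL1 : 2 ≤ ((L : ℝ) + 1) * δ)
    (hL : 4 ≤ L) {v : Site 2}
    (hbd : (|v 0 + v 1| ≤ L ∧ |v 0 - v 1| ≤ L) ∧ (L - 1 ≤ |v 0 + v 1| ∨ L - 1 ≤ |v 0 - v 1|))
    (hnot : ¬ (L - 1 ≤ v 0 + v 1 ∧ v 0 + v 1 ≤ L ∧ |v 0 - v 1| ≤ L - 3)) :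
    infDist (meshPoint δ v) (anchorData δ).arcA < infDist (meshPoint δ v) (anchorData δ).arcB := by
  obtain ⟨⟨hs, hdL⟩, hnear⟩ := hbd
  have hcase : (L - 1 ≤ v 0 + v 1 ∧ L - 2 ≤ |v 0 - v 1|) ∨ (v 0 + v 1 ≤ -(L - 1)) ∨
      (v 0 + v 1 ≤ L - 2 ∧ L - 1 ≤ |v 0 - v 1|) := by
    simp only [abs_le, le_abs'] at hs hdL hnear hnot ⊢
    omega
  rw [abs_le] at hs
  rcases hcase with ⟨h1, h2⟩ | h1 | ⟨h1, h2⟩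
  · exact infDist_lt_of_ends hδ hLδ hL1 hL h1 hs.2 h2 hdL
  · exact infDist_lt_of_bottom hδ hLδ hL1 hL hs.1 h1 hdL
  · exact infDist_lt_of_lateral hδ hLδ hL1 hL hs.1 h1 h2 hdL

/-! ## The discrete arcs -/

/-- Unfolding `zdArcB` for the anchor data. [folklore] -/
theorem mem_zdArcB_iff' {v : Site 2} : v ∈ (anchorData δ).zdArcB ↔ v ∈ (anchorData δ).zdBoundary ∧
    infDist (meshPoint δ v) (anchorData δ).arcB ≤ infDist (meshPoint δ v) (anchorData δ).arcA :=
  Iff.rfl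

/-- Unfolding `zdArcA` for the anchor data. [folklore] -/
theorem mem_zdArcA_iff' (hδ : 0 < δ) (hLδ : (L : ℝ) * δ < 2) (hL1 : 2 ≤ ((L : ℝ) + 1) * δ)
    {v : Site 2} : v ∈ (anchorData δ).zdArcA ↔ v ∈ (anchorData δ).zdBoundary ∧
      infDist (meshPoint δ v) (anchorData δ).arcA ≤ infDist (meshPoint δ v) (anchorData δ).arcB := by
  rw [DiscreteDobrushin.zdArcA, DiscreteDobrushin.mem_zdDiscreteArc_iff, frontier_diff_arcA hδ hLδ hL1]
  rfl

/-- **The discrete free arc of the anchor data** is the free window `L - 1 ≤ s ≤ L`, `|d| ≤ L - 3`.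
[folklore] -/
theorem mem_zdArcB_iff (hδ : 0 < δ) (hLδ : (L : ℝ) * δ < 2) (hL1 : 2 ≤ ((L : ℝ) + 1) * δ) (hL : 4 ≤ L)
    (v : Site 2) : v ∈ (anchorData δ).zdArcB ↔
      (L - 1 ≤ v 0 + v 1 ∧ v 0 + v 1 ≤ L ∧ |v 0 - v 1| ≤ L - 3) := by
  rw [mem_zdArcB_iff', S5.mem_zdBoundary_anchor_iff (E := anchorData δ) rfl rfl hδ (by omega) hLδ hL1]
  constructor
  · rintro ⟨hbd, hle⟩
    by_contra hnot
    exact absurd hle (not_le.2 (infDist_lt_of_wired hδ hLδ hL1 hL hbd hnot))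
  · rintro ⟨hs, hsL, hd⟩
    refine ⟨?_, (infDist_lt_of_free hδ hLδ hL1 hL hs hsL hd).le⟩
    simp only [abs_le, le_abs'] at hd ⊢
    omega

/-- **The discrete wired arc of the anchor data** is the rest of the discrete boundary. [folklore] -/
theorem mem_zdArcA_iff (hδ : 0 < δ) (hLδ : (L : ℝ) * δ < 2) (hL1 : 2 ≤ ((L : ℝ) + 1) * δ) (hL : 4 ≤ L)
    (v : Site 2) : v ∈ (anchorData δ).zdArcA ↔
      (v ∈ (anchorData δ).zdBoundary ∧ ¬ (L - 1 ≤ v 0 + v 1 ∧ |v 0 - v 1| ≤ L - 3)) := by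
  rw [mem_zdArcA_iff' hδ hLδ hL1]
  refine and_congr_right fun hbd => ?_
  have hbd' := (S5.mem_zdBoundary_anchor_iff (E := anchorData δ) rfl rfl hδ (by omega) hLδ hL1 v).1 hbd
  constructor
  · rintro hle ⟨hs, hd⟩
    exact absurd hle (not_le.2 (infDist_lt_of_free hδ hLδ hL1 hL hs (abs_le.1 hbd'.1.1).2 hd))
  · intro hnot
    exact (infDist_lt_of_wired hδ hLδ hL1 hL hbd' fun h => hnot ⟨h.1, h.2.2⟩).le

end AnchorLattice

open AnchorLattice in
/-- **Registered one-line form `stub_anchorData_arcs`** (helper of the sub-goal `stub_anchorData_lattice` of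
`stub_anchorMoment_of_IP`, line `strip-anchored-vertex-normalisation`, skeleton r4): at a mesh `δ > 0` with
`L δ < 2 ≤ (L + 1) δ`, `L ≥ 4`, the discrete free arc of `anchorData δ` is the free window
`{L - 1 ≤ v₀ + v₁ ≤ L, |v₀ - v₁| ≤ L - 3}` and the discrete wired arc is the rest of the discrete boundary.
[folklore] -/
theorem stub_anchorData_arcs : ∀ (δ : ℝ) (L : ℤ), 0 < δ → (L : ℝ) * δ < 2 → 2 ≤ ((L : ℝ) + 1) * δ → 4 ≤ L → ∀ v : Site 2, (v ∈ (anchorData δ).zdArcB ↔ (L - 1 ≤ v 0 + v 1 ∧ v 0 + v 1 ≤ L ∧ |v 0 - v 1| ≤ L - 3)) ∧ (v ∈ (anchorData δ).zdArcA ↔ (v ∈ (anchorData δ).zdBoundary ∧ ¬ (L - 1 ≤ v 0 + v 1 ∧ |v 0 - v 1| ≤ L - 3))) :=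
  fun _ _ hδ hLδ hL1 hL v => ⟨mem_zdArcB_iff hδ hLδ hL1 hL v, mem_zdArcA_iff hδ hLδ hL1 hL v⟩

end Summit.CriticalPhenomena.CardyFormulaZ2.Theorems.ParafermionFamiliesToSLESix.StripAnchored

end
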